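import Literature.Geometry.Kaehler.RiemannSurfaceChartSupportedForms
import Literature.Geometry.Kaehler.HolomorphicFunctionsDolbeault
import Literature.Geometry.Kaehler.RiemannSurfaceHarmonicConjugate
import Literature.Analysis.Complex.PQExtDeriv
import Literature.Analysis.Complex.RiemannSphereDbar
import HarnessLib

/-!
# Chart calculus on a Riemann surface: `d(P dz + Q dz̄) = (∂Q - ∂̄P) dz ∧ dz̄`, closedness read in a
# chart, the differential of a function `df = ∂f dz + ∂̄f dz̄`, and holomorphy `⟺ ∂̄f = 0`
# (Forster §9.9–9.13)

Layer `Literature/Geometry/Kaehler`, sequel of `RiemannSurfaceOneFormsAsSmoothForms` (the forms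
`a dz`, `b dz̄`, `c dz ∧ dz̄`, the coefficients `coeffOneZero`, `coeffZeroOne`) and
`RiemannSurfaceChartSupportedForms`. O. Forster, *Lectures on Riemann Surfaces*, GTM 81 (1981), §9, as
printed: 9.9 «`df = ∂f/∂z dz + ∂f/∂z̄ dz̄` … `d′f = ∂f/∂z dz`, `d″f = ∂f/∂z̄ dz̄`»; 9.11 (i)
`d(fω) = df ∧ ω + f dω`, (iii) «a differentiable function `f ∈ 𝓔(U)` is holomorphic precisely if
`d″f = 0`»; 9.13 «`ω = f dz + g dz̄` … `dω = (∂g/∂z - ∂f/∂z̄) dz ∧ dz̄`». Here, with the tree's Wirtinger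
derivatives `∂̄ = dbarAlong 1`, `∂ = delAlong 1` (`Literature/Analysis/Complex`):

* §1 (plane) **`extDeriv_smul_dzForm_add_smul_dzbarForm`** — 9.13: for `P, Q : ℂ → ℂ` real-
  differentiable at `y`, `d(P dz + Q dz̄)(y) = (∂Q(y) - ∂̄P(y)) dz ∧ dz̄` (Mathlib's `extDeriv`);
  `extDeriv_smul_dzForm`, `extDeriv_smul_dzbarForm`;
* §2 (Riemann surface `M`) **`mextDeriv_eq_zero_of_extDeriv_inChart_eq_zero`** — a form smooth at a
  point `x` of the chart `z_p` with `d(α^_{z_p})(z_p x) = 0` has `dα(x) = 0`; combined: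
  **`mextDeriv_eq_zero_of_inChart_eventuallyEq`** (representative `P dz + Q dz̄` near `z_p x` with
  `∂Q = ∂̄P` there `⟹ dα(x) = 0`);
* §3 functions: **`coeffZeroOne_mextDeriv_ofFun`** / **`coeffOneZero_mextDeriv_ofFun`** — 9.9: the
  `dz̄_x`- and `dz_x`-coefficients of `df` at `x` are `∂̄(f ∘ z_x⁻¹)(z_x x)` and `∂(f ∘ z_x⁻¹)(z_x x)`;
  **`dbarAlong_comp_chartAt_symm_eq`** — change of chart for `∂̄f`:
  `∂̄(f∘z_x⁻¹)(z_x x) = conj((z_p ∘ z_x⁻¹)′(z_x x)) · ∂̄(f∘z_p⁻¹)(z_p x)`;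
  `deriv_chartAt_comp_symm_mul_deriv` (`(z_p∘z_x⁻¹)′ (z_x∘z_p⁻¹)′ = 1`);
  **`mdifferentiableAt_of_dbarAlong_eq_zero`** — 9.11 (iii): `f` real-differentiable in a chart at
  `x` with `∂̄(f∘z_x⁻¹)(z_x x) = 0` is holomorphic at `x`.

Everything is proved; no named facts, no instances.

## References

* O. Forster, *Lectures on Riemann Surfaces*, GTM 81, Springer (1981), §9.9, §9.11, §9.13.
  [Forster1981]
* L. Hörmander, *An Introduction to Complex Analysis in Several Variables* (1973), §1.1 (the
  operators `∂/∂z`, `∂/∂z̄`). [HormanderSCV1973]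
-/

noncomputable section

open scoped Manifold ContDiff Topology ComplexConjugate
open Set Filter Function Complex
open Literature.NumberTheory.Transcendental Literature.Analysis.Complex

namespace Literature.Geometry.Kaehler

/-! ### §1 Plane: `d(P dz + Q dz̄) = (∂Q - ∂̄P) dz ∧ dz̄` -/

section Plane

/-- `Dc(y)[v] = ∂c(y) v + ∂̄c(y) v̄` for the real derivative of `c : ℂ → ℂ` (Forster 9.9:
`df = ∂f/∂z dz + ∂f/∂z̄ dz̄`). [cite: Forster1981, §9.9] -/
theorem fderiv_apply_eq_delAlong_add_dbarAlong (c : ℂ → ℂ) (y v : ℂ) :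
    fderiv ℝ c y v = delAlong 1 c y * v + dbarAlong 1 c y * conj v := by
  have h := fderiv_apply_smul_eq c y v 1
  rw [smul_eq_mul, mul_one] at h
  rw [h, smul_eq_mul, smul_eq_mul]
  ring

/-- **Forster 9.13: `d(P dz + Q dz̄) = (∂Q - ∂̄P) dz ∧ dz̄`** for `P, Q` real-differentiable at the
point (Mathlib's exterior derivative of the plane form `y ↦ P(y) dz + Q(y) dz̄`).
[cite: Forster1981, §9.13] -/
theorem extDeriv_smul_dzForm_add_smul_dzbarForm {P Q : ℂ → ℂ} {y : ℂ}
    (hP : DifferentiableAt ℝ P y) (hQ : DifferentiableAt ℝ Q y) :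
    extDeriv (fun y ↦ (P y • dzForm + Q y • dzbarForm : ℂ [⋀^Fin 1]→L[ℝ] ℂ)) y =
      (delAlong 1 Q y - dbarAlong 1 P y) • dzdzbarForm := by
  have hω : DifferentiableAt ℝ
      (fun y ↦ (P y • dzForm + Q y • dzbarForm : ℂ [⋀^Fin 1]→L[ℝ] ℂ)) y :=
    (hP.smul_const _).add (hQ.smul_const _)
  ext v
  rw [extDeriv_apply hω, ContinuousAlternatingMap.smul_apply, dzdzbarForm_apply, smul_eq_mul]
  have hcomp : ∀ w : Fin 1 → ℂ,
      (fun y ↦ (P y • dzForm + Q y • dzbarForm : ℂ [⋀^Fin 1]→L[ℝ] ℂ) w) =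
        fun y ↦ P y * w 0 + Q y * conj (w 0) := by
    intro w
    funext y
    simp [dzForm_apply, dzbarForm_apply]
  have hderiv : ∀ (w : Fin 1 → ℂ) (u : ℂ),
      fderiv ℝ (fun y ↦ (P y • dzForm + Q y • dzbarForm : ℂ [⋀^Fin 1]→L[ℝ] ℂ) w) y u =
        fderiv ℝ P y u * w 0 + fderiv ℝ Q y u * conj (w 0) := by
    intro w u
    rw [hcomp w, fderiv_fun_add (hP.mul_const _) (hQ.mul_const _), fderiv_mul_const hP,
      fderiv_mul_const hQ]
    change w 0 * fderiv ℝ P y u + (starRingEnd ℂ) (w 0) * fderiv ℝ Q y u = _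
    ring
  have h0 : (Fin.removeNth (0 : Fin 2) v) 0 = v 1 := by
    simp [Fin.removeNth]
  have h1 : (Fin.removeNth (1 : Fin 2) v) 0 = v 0 := by
    simp [Fin.removeNth]
  rw [Fin.sum_univ_two, hderiv, hderiv, h0, h1]
  simp only [Fin.val_zero, pow_zero, one_smul, Fin.val_one, pow_one, neg_smul,
    fderiv_apply_eq_delAlong_add_dbarAlong]
  ring

/-- `∂` of a constant vanishes. [folklore] -/
private theorem delAlong_const (c y : ℂ) : delAlong 1 (fun _ : ℂ ↦ c) y = 0 := by
  simp [delAlong_apply, fderiv_const_apply]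

/-- `∂̄` of a constant vanishes. [folklore] -/
private theorem dbarAlong_const (c y : ℂ) : dbarAlong 1 (fun _ : ℂ ↦ c) y = 0 := by
  simp [dbarAlong_apply, fderiv_const_apply]

/-- **`d(P dz) = -∂̄P dz ∧ dz̄`.** [cite: Forster1981, §9.13] -/
theorem extDeriv_smul_dzForm {P : ℂ → ℂ} {y : ℂ} (hP : DifferentiableAt ℝ P y) :
    extDeriv (fun y ↦ (P y • dzForm : ℂ [⋀^Fin 1]→L[ℝ] ℂ)) y =
      (-dbarAlong 1 P y) • dzdzbarForm := by
  have h := extDeriv_smul_dzForm_add_smul_dzbarForm hP (differentiableAt_const (0 : ℂ))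
  have hfun : (fun y ↦ (P y • dzForm + (0 : ℂ) • dzbarForm : ℂ [⋀^Fin 1]→L[ℝ] ℂ)) =
      fun y ↦ (P y • dzForm : ℂ [⋀^Fin 1]→L[ℝ] ℂ) := by
    funext y; ext v; simp
  rw [hfun] at h
  rw [h, delAlong_const, zero_sub]

/-- **`d(Q dz̄) = ∂Q dz ∧ dz̄`.** [cite: Forster1981, §9.13] -/
theorem extDeriv_smul_dzbarForm {Q : ℂ → ℂ} {y : ℂ} (hQ : DifferentiableAt ℝ Q y) :
    extDeriv (fun y ↦ (Q y • dzbarForm : ℂ [⋀^Fin 1]→L[ℝ] ℂ)) y =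
      (delAlong 1 Q y) • dzdzbarForm := by
  have h := extDeriv_smul_dzForm_add_smul_dzbarForm (differentiableAt_const (0 : ℂ)) hQ
  have hfun : (fun y ↦ ((0 : ℂ) • dzForm + Q y • dzbarForm : ℂ [⋀^Fin 1]→L[ℝ] ℂ)) =
      fun y ↦ (Q y • dzbarForm : ℂ [⋀^Fin 1]→L[ℝ] ℂ) := by
    funext y; ext v; simp
  rw [hfun] at h
  rw [h, dbarAlong_const, sub_zero]

/-- For a complex-differentiable `c`, `∂c = c′` (and `∂̄c = 0`). [cite: Forster1981, §9.11] -/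
theorem delAlong_eq_deriv_of_differentiableAt {c : ℂ → ℂ} {y : ℂ} (hc : DifferentiableAt ℂ c y) :
    delAlong 1 c y = deriv c y := by
  have h := fderiv_apply_eq_delAlong_add_dbarAlong c y 1
  rw [dbarAlong_eq_zero_of_differentiableAt hc 1, zero_mul, add_zero, mul_one,
    hc.fderiv_restrictScalars ℝ, ContinuousLinearMap.coe_restrictScalars',
    fderiv_apply_one_eq_deriv] at h
  exact h.symm

end Plane

/-! ### §2 Closedness read in a chart -/

namespace RiemannSurface

variable {M : Type*} [TopologicalSpace M] [ChartedSpace ℂ M] [IsManifold 𝓘(ℂ, ℂ) ω M]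

/-- **A form whose chart representative has vanishing exterior derivative at `z_p x` is closed at
`x`** (`x` in the source of `z_p`, the form smooth at `x`): `dα(x)` is `d(α^_{z_p})(z_p x)` pulled
back by the invertible tangent coordinate change. [cite: Forster1981, §9.13] -/
theorem mextDeriv_eq_zero_of_extDeriv_inChart_eq_zero [IsManifold 𝓘(ℝ, ℂ) ∞ M] {k : ℕ}
    {α : MForm 𝓘(ℝ, ℂ) M ℂ k} {p x : M}
    (hx : x ∈ (chartAt ℂ p).source) (hα : α.SmoothAt x)
    (h : extDeriv (α.inChart p) (chartAt ℂ p x) = 0) : mextDeriv α x = 0 := by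
  have hx' : x ∈ (extChartAt 𝓘(ℝ, ℂ) p).source := by simpa using hx
  have hy : extChartAt 𝓘(ℝ, ℂ) p x ∈ (extChartAt 𝓘(ℝ, ℂ) p).target :=
    (extChartAt 𝓘(ℝ, ℂ) p).map_source hx'
  have hxx : (extChartAt 𝓘(ℝ, ℂ) p).symm (extChartAt 𝓘(ℝ, ℂ) p x) = x :=
    (extChartAt 𝓘(ℝ, ℂ) p).left_inv hx'
  have hα' : α.SmoothAt ((extChartAt 𝓘(ℝ, ℂ) p).symm (extChartAt 𝓘(ℝ, ℂ) p x)) := by rwa [hxx]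
  have hin := inChart_mextDeriv_of_mem_target α hy hα'
  rw [ModelWithCorners.Boundaryless.range_eq_univ, extDerivWithin_univ] at hin
  have hpx : extChartAt 𝓘(ℝ, ℂ) p x = chartAt ℂ p x := by simp
  rw [hpx] at hin
  rw [h] at hin
  -- `(dα).inChart p (z_p x) = dα(x) ∘ τ` with `τ` multiplication by a nonzero number
  rw [← hpx, MForm.inChart_eq_of_mem_target _ hy, hxx] at hin
  set T : ℂ := deriv (chartAt ℂ x ∘ (chartAt ℂ p).symm) (chartAt ℂ p x) with hT
  have hT0 : T ≠ 0 := by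
    have := deriv_chartAt_comp_symm_ne_zero (M := M) ((chartAt ℂ p).map_source hx)
    rwa [(chartAt ℂ p).left_inv hx] at this
  have hτ : ∀ w : ℂ, tangentCoordChange 𝓘(ℝ, ℂ) p x x w = T * w := fun w ↦
    tangentCoordChange_self_apply_eq_deriv_mul hx w
  ext v
  have hv := congrArg (fun φ : ℂ [⋀^Fin (k + 1)]→L[ℝ] ℂ ↦ φ (fun i ↦ (letI V : ℂ := v i; T⁻¹ * V)))
    hin
  simp only [ContinuousAlternatingMap.compContinuousLinearMap_apply, comp_def,
    ContinuousAlternatingMap.coe_zero, Pi.zero_apply] at hv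
  have hid : (fun i ↦ tangentCoordChange 𝓘(ℝ, ℂ) p x x (letI V : ℂ := v i; T⁻¹ * V)) = v := by
    funext i
    rw [hτ, ← mul_assoc, mul_inv_cancel₀ hT0, one_mul]
  exact (congrArg (mextDeriv α x) hid.symm).trans hv

/-- **Closedness from the chart representative `P dz + Q dz̄` (Forster 9.13)**: if near `z_p x` the
representative of `α` in the chart `z_p` is `P dz + Q dz̄` with `P, Q` real-differentiable at
`z_p x` and `∂Q(z_p x) = ∂̄P(z_p x)`, then `dα(x) = 0`. [cite: Forster1981, §9.13] -/
theorem mextDeriv_eq_zero_of_inChart_eventuallyEq [IsManifold 𝓘(ℝ, ℂ) ∞ M] {α : MForm 𝓘(ℝ, ℂ) M ℂ 1}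
    {p x : M}
    (hx : x ∈ (chartAt ℂ p).source) (hα : α.SmoothAt x) {P Q : ℂ → ℂ}
    (heq : α.inChart p =ᶠ[𝓝 (chartAt ℂ p x)]
      fun y ↦ (P y • dzForm + Q y • dzbarForm : ℂ [⋀^Fin 1]→L[ℝ] ℂ))
    (hP : DifferentiableAt ℝ P (chartAt ℂ p x)) (hQ : DifferentiableAt ℝ Q (chartAt ℂ p x))
    (hPQ : delAlong 1 Q (chartAt ℂ p x) = dbarAlong 1 P (chartAt ℂ p x)) :
    mextDeriv α x = 0 := by
  refine mextDeriv_eq_zero_of_extDeriv_inChart_eq_zero hx hα ?_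
  rw [heq.extDeriv_eq, extDeriv_smul_dzForm_add_smul_dzbarForm hP hQ, hPQ, sub_self]
  exact zero_smul ℂ (dzdzbarForm : ℂ [⋀^Fin 2]→L[ℝ] ℂ)

/-! ### §3 Functions: `df = ∂f dz + ∂̄f dz̄`, change of chart for `∂̄f`, holomorphy -/

omit [IsManifold 𝓘(ℂ, ℂ) ω M] in
/-- The differential of a function evaluated on `![w]`: `df_x(w) = D(f ∘ z_x⁻¹)(z_x x)[w]`.
[cite: Forster1981, §9.9] -/
theorem mextDeriv_ofFun_apply_vecOne [IsManifold 𝓘(ℝ, ℂ) ∞ M] (f : M → ℂ) (x : M) (w : ℂ) :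
    mextDeriv (MForm.ofFun 𝓘(ℝ, ℂ) f) x ![w] =
      fderiv ℝ (f ∘ (chartAt ℂ x).symm) (chartAt ℂ x x) w := by
  have h1 : f ∘ (extChartAt 𝓘(ℝ, ℂ) x).symm = f ∘ (chartAt ℂ x).symm := by
    funext y; simp
  have h2 : extChartAt 𝓘(ℝ, ℂ) x x = chartAt ℂ x x := by simp
  rw [mextDeriv_ofFun_apply', h1, h2]
  rfl

omit [IsManifold 𝓘(ℂ, ℂ) ω M] in
/-- **Forster 9.9, the `dz̄`-coefficient of `df` is `∂f/∂z̄`**: at `x`, against the frame of the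
preferred chart `z_x`, `coeffZeroOne (df) x = ∂̄(f ∘ z_x⁻¹)(z_x x)`. [cite: Forster1981, §9.9] -/
theorem coeffZeroOne_mextDeriv_ofFun [IsManifold 𝓘(ℝ, ℂ) ∞ M] (f : M → ℂ) (x : M) :
    coeffZeroOne (mextDeriv (MForm.ofFun 𝓘(ℝ, ℂ) f)) x =
      dbarAlong 1 (f ∘ (chartAt ℂ x).symm) (chartAt ℂ x x) := by
  rw [coeffZeroOne, mextDeriv_ofFun_apply_vecOne, mextDeriv_ofFun_apply_vecOne, dbarAlong_one,
    smul_eq_mul, smul_eq_mul]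
  ring

omit [IsManifold 𝓘(ℂ, ℂ) ω M] in
/-- **Forster 9.9, the `dz`-coefficient of `df` is `∂f/∂z`**: `coeffOneZero (df) x = ∂(f ∘ z_x⁻¹)(z_x x)`.
[cite: Forster1981, §9.9] -/
theorem coeffOneZero_mextDeriv_ofFun [IsManifold 𝓘(ℝ, ℂ) ∞ M] (f : M → ℂ) (x : M) :
    coeffOneZero (mextDeriv (MForm.ofFun 𝓘(ℝ, ℂ) f)) x =
      delAlong 1 (f ∘ (chartAt ℂ x).symm) (chartAt ℂ x x) := by
  rw [coeffOneZero, mextDeriv_ofFun_apply_vecOne, mextDeriv_ofFun_apply_vecOne, delAlong_apply,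
    smul_eq_mul, smul_eq_mul, smul_eq_mul, mul_one]
  ring

/-- `(z_p ∘ z_x⁻¹)′(z_x x) · (z_x ∘ z_p⁻¹)′(z_p x) = 1` for `x` in the source of `z_p`.
[cite: Miranda1995, Chapter IV Definition 1.2] -/
theorem deriv_chartAt_comp_symm_mul_deriv {p x : M} (hx : x ∈ (chartAt ℂ p).source) :
    deriv (chartAt ℂ p ∘ (chartAt ℂ x).symm) (chartAt ℂ x x) *
      deriv (chartAt ℂ x ∘ (chartAt ℂ p).symm) (chartAt ℂ p x) = 1 := by
  have h := deriv_coordChange_eq_mul (e₁ := chartAt ℂ p) (e₂ := chartAt ℂ x) (e₃ := chartAt ℂ p)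
    (mdifferentiableOn_atlas (I := 𝓘(ℂ, ℂ)) (chart_mem_atlas ℂ p))
    (mdifferentiableOn_atlas (I := 𝓘(ℂ, ℂ)) (chart_mem_atlas ℂ x))
    (mdifferentiableOn_atlas_symm (I := 𝓘(ℂ, ℂ)) (chart_mem_atlas ℂ x))
    (mdifferentiableOn_atlas_symm (I := 𝓘(ℂ, ℂ)) (chart_mem_atlas ℂ p))
    ((chartAt ℂ p).map_source hx) (by rw [(chartAt ℂ p).left_inv hx]; exact hx)
    (by rw [(chartAt ℂ p).left_inv hx]; exact mem_chart_source ℂ x)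
  rw [deriv_coordChange_self _ ((chartAt ℂ p).map_source hx), (chartAt ℂ p).left_inv hx] at h
  exact h.symm

/-- **Change of chart for `∂̄f`**: for `x` in the source of `z_p` and `f ∘ z_p⁻¹` real-differentiable
at `z_p x`, `∂̄(f ∘ z_x⁻¹)(z_x x) = conj((z_p ∘ z_x⁻¹)′(z_x x)) · ∂̄(f ∘ z_p⁻¹)(z_p x)` (the transition
map is holomorphic; a `(0,1)`-coefficient transforms with the conjugate derivative).
[cite: Forster1981, §9.9] -/
theorem dbarAlong_comp_chartAt_symm_eq {f : M → ℂ} {p x : M} (hx : x ∈ (chartAt ℂ p).source)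
    (hf : DifferentiableAt ℝ (f ∘ (chartAt ℂ p).symm) (chartAt ℂ p x)) :
    dbarAlong 1 (f ∘ (chartAt ℂ x).symm) (chartAt ℂ x x) =
      conj (deriv (chartAt ℂ p ∘ (chartAt ℂ x).symm) (chartAt ℂ x x)) *
        dbarAlong 1 (f ∘ (chartAt ℂ p).symm) (chartAt ℂ p x) := by
  set T : ℂ → ℂ := chartAt ℂ p ∘ (chartAt ℂ x).symm with hT
  have hTx : T (chartAt ℂ x x) = chartAt ℂ p x := by
    simp [hT, (chartAt ℂ x).left_inv (mem_chart_source ℂ x)]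
  -- `f ∘ z_x⁻¹ = (f ∘ z_p⁻¹) ∘ T` near `z_x x`
  have hev : f ∘ (chartAt ℂ x).symm =ᶠ[𝓝 (chartAt ℂ x x)] (f ∘ (chartAt ℂ p).symm) ∘ T := by
    have h1 : ∀ᶠ z in 𝓝 (chartAt ℂ x x), (chartAt ℂ x).symm z ∈ (chartAt ℂ p).source := by
      refine (chartAt ℂ x).continuousAt_symm (mem_chart_target ℂ x) |>.eventually ?_
      rw [(chartAt ℂ x).left_inv (mem_chart_source ℂ x)]
      exact (chartAt ℂ p).open_source.mem_nhds hx
    filter_upwards [h1] with z hz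
    simp only [hT, comp_apply, (chartAt ℂ p).left_inv hz]
  have hTd : HasDerivAt T (deriv T (chartAt ℂ x x)) (chartAt ℂ x x) :=
    (differentiableAt_coordChange (mdifferentiableOn_atlas (I := 𝓘(ℂ, ℂ)) (chart_mem_atlas ℂ p))
      (mdifferentiableOn_atlas_symm (I := 𝓘(ℂ, ℂ)) (chart_mem_atlas ℂ x)) (mem_chart_target ℂ x)
      (by rw [(chartAt ℂ x).left_inv (mem_chart_source ℂ x)]; exact hx)).hasDerivAt
  have hf' : DifferentiableAt ℝ (f ∘ (chartAt ℂ p).symm) (T (chartAt ℂ x x)) := by rwa [hTx]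
  rw [dbarAlong_congr_of_eventuallyEq hev 1, comp_def,
    Literature.Analysis.Complex.RiemannSphere.dbarAlong_one_comp_of_hasDerivAt hTd hf', hTx,
    smul_eq_mul]

/-- **Forster 9.11 (iii): holomorphy is `∂̄f = 0`.** If `f ∘ z_x⁻¹` is real-differentiable at `z_x x`
with `∂̄(f ∘ z_x⁻¹)(z_x x) = 0`, then `f` is holomorphic (complex differentiable as a map of
manifolds) at `x`. [cite: Forster1981, §9.11] -/
theorem mdifferentiableAt_of_dbarAlong_eq_zero {f : M → ℂ} {x : M}
    (hf : DifferentiableAt ℝ (f ∘ (chartAt ℂ x).symm) (chartAt ℂ x x))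
    (h0 : dbarAlong 1 (f ∘ (chartAt ℂ x).symm) (chartAt ℂ x x) = 0) :
    MDifferentiableAt 𝓘(ℂ, ℂ) 𝓘(ℂ, ℂ) f x := by
  have hC : DifferentiableAt ℂ (f ∘ (chartAt ℂ x).symm) (chartAt ℂ x x) := by
    refine (differentiableAt_complex_iff_dbarAlong_eq_zero hf).2 fun v ↦ ?_
    rw [show v = v • (1 : ℂ) by rw [smul_eq_mul, mul_one], dbarAlong_smul_left, h0, smul_zero]
  exact (mdifferentiableAt_iff_differentiableAt_chart (chart_mem_atlas ℂ x) (mem_chart_source ℂ x)).2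
    hC

/-- Conversely, a holomorphic `f` has `∂̄(f ∘ z_p⁻¹)(z_p x) = 0` in every chart `z_p` around `x`.
[cite: Forster1981, §9.11] -/
theorem dbarAlong_comp_symm_eq_zero_of_mdifferentiableAt {f : M → ℂ} {p x : M}
    (hx : x ∈ (chartAt ℂ p).source) (hf : MDifferentiableAt 𝓘(ℂ, ℂ) 𝓘(ℂ, ℂ) f x) :
    dbarAlong 1 (f ∘ (chartAt ℂ p).symm) (chartAt ℂ p x) = 0 :=
  dbarAlong_eq_zero_of_differentiableAt
    ((mdifferentiableAt_iff_differentiableAt_chart (chart_mem_atlas ℂ p) hx).1 hf) 1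

end RiemannSurface

end Literature.Geometry.Kaehler

end
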